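import Summits.Ventures.CertifiedManyBodySolver.Downfold.EmeryOrbitalWeightFaceCoord
import Summits.Ventures.CertifiedManyBodySolver.Downfold.EmeryOrbitalWeightShell
import Summits.Ventures.CertifiedManyBodySolver.Downfold.EmeryFermiEnergyExistsAll
import Summits.Ventures.CertifiedManyBodySolver.Downfold.EmeryScalingLaw
import Summits.Ventures.CertifiedManyBodySolver.Downfold.EmeryVanHoveDoping
import HarnessLib

/-!
# The ANTINODAL Fermi-surface Cu-d weight at FIXED FILLING — scale invariance, hole-likeness from the van Hove filling, and the three one-coordinate steps
# (INFL-3to1-B §B.90, part 1 of 2: the kinematic leg of the UPPER member `U_B∣full(w_antinode)` of the weak band-level `U` bracket, read over a box; the corner rule is in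
# the sequel `EmeryOrbitalWeightFaceBox`)

Venture CertifiedManyBodySolver, cell `pub/hubbard-downfold` (stage S1; INFLATION-RULES-3to1-B §B.72 (g)/(i) «the weak bracket U_B∣₀(w_node) < U_1b < U_B∣full(w_antinode)
is construction-stable», §B.73 (the antinodal doping lever), §B.89 (c) (the nodal weight over a box), §B.90 (this file)), seat hubbard-downfold-mod-4 (technique B, g38);
namespace `Summit.Ventures.CertifiedManyBodySolver.Downfold.Emery`. Sequel of `EmeryOrbitalWeightFaceCoord` (the fixed-ENERGY coordinate levers of the closed form
`w_face = t_pd²faceN/(t_pd²faceN + faceR)`: `Δ ↑` and `t_pp′ ↑` in the antinodal charge-transfer regime `4(t_pp + t_pp′) ≤ Δ + ε`, `t_pp ↓` on the hole-like window),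
`EmeryOrbitalWeightShell` (`dWeightFace_antitone`: `ε ↓` on the face window), the Fermi-energy levers (`EmeryChargeTransferLipschitz`, `EmeryHoppingLevers`), the scaling
law (`EmeryScalingLaw`) and the van Hove filling (`EmeryVanHoveDoping`). Everything PROVED (0 sorry).
WHAT THIS IS NOT: a statement about any material; `U = 0` one-body kinematics of the σ (d–pₓ–p_y + t_pp + t_pp′) model; the weight enters the band-level `U` ANNEX
`U_B(w) = w²U_dd + (1 − w)²U_pp/4 + 2w(1 − w)U_dp` (`EmeryBandLevelU`, a mean-field projection — EXTRAPOLATED-grade context by R-B17, never a box member).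

* §1 SCALE INVARIANCE: `dWeightFace(λθ; λε) = dWeightFace(θ; ε)`, hence at fixed filling `W(θ) := dWeightFace(θ; ε_F(θ; ν))` depends on the RATIOS `(Δ/t_pd, t_pp/t_pd, t_pp′/t_pd)`
  only (`dWeightFace_fermiEnergyOf_eq_ratios`) — the t_pd coordinate of a box is absorbed by normalising to `t_pd = 1` (its fixed-filling lever is sign-indefinite: the
  fixed-energy lever `t_pd ↑` and the energy channel `ε_F ↑ in t_pd`, `w ↓ in ε` compete).
* §2 HOLE-LIKENESS FROM THE VAN HOVE FILLING: `1 − 2ν ≤ x_VH(θ)` ⇒ `ε_VH(θ) ≤ ε_F(θ; ν)` ⇒ `faceG(θ; ε_F) ≥ 0` (the Fermi surface of filling `ν` reaches the zone face) — the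
  certified `x_VH` box windows (`EmeryVanHove<Tag>`) discharge the window hypothesis for every member at once.
* §3 THE FIXED-FILLING ONE-COORDINATE STEPS: `Δ ↑ ⇒ W ↑` (fixed-energy Δ-lever, then `ε_F ↓ in Δ` and the energy lever), `t_pp ↑ ⇒ W ↓` (energy lever at the larger
  `t_pp`, then the t_pp-lever), `t_pp′ ↑ ⇒ W ↑` (t_pp′-lever, then the energy lever) — each under the window / regime hypotheses AT THE POINTS IT VISITS.
* §4–§5 (the three-coordinate corner rule at fixed `t_pd` and the four-coordinate box by normalisation): sequel `EmeryOrbitalWeightFaceBox`.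

Sources: three-band model [HybertsenSchluterChristensen1989, Eq. (1)]; bilinear contour / face point [AndersenEtAl1995, §6]; [folklore] algebra.
-/

noncomputable section

namespace Summit.Ventures.CertifiedManyBodySolver.Downfold.Emery

open Real Set

/-! ## §1 Scale invariance of the antinodal weight -/

/-- `cA` is homogeneous of degree 3. [folklore] -/
theorem cA_smul (l Δ ε : ℝ) : cA (l * Δ) (l * ε) = l ^ 3 * cA Δ ε := by
  unfold cA; ring

/-- `faceG` is homogeneous of degree 2. [folklore] -/
theorem faceG_smul (l Δ tpd c ε : ℝ) : faceG (l * Δ) (l * tpd) (l * c) (l * ε) = l ^ 2 * faceG Δ tpd c ε := by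
  unfold faceG; ring

/-- The face ordinate `yFace` is scale invariant (`λ ≠ 0`). [folklore] -/
theorem yFace_smul {l : ℝ} (hl : l ≠ 0) (Δ tpd tpp c ε : ℝ) :
    yFace (l * Δ) (l * tpd) (l * tpp) (l * c) (l * ε) = yFace Δ tpd tpp c ε := by
  unfold yFace
  rw [cA_smul, fsD_smul, fsN_smul]
  have h3 : l ^ 3 ≠ 0 := pow_ne_zero 3 hl
  rw [show l ^ 3 * cA Δ ε - 4 * (l ^ 3 * fsD Δ tpd c ε) = l ^ 3 * (cA Δ ε - 4 * fsD Δ tpd c ε) by ring,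
    show 4 * (l ^ 3 * fsD Δ tpd c ε) + 16 * (l ^ 3 * fsN tpd tpp c ε) = l ^ 3 * (4 * fsD Δ tpd c ε + 16 * fsN tpd tpp c ε) by ring,
    mul_div_mul_left _ _ h3]

/-- **The antinodal Cu-d weight is scale invariant**: `dWeightFace(λΔ, λt_pd, λt_pp, λt_pp′; λε) = dWeightFace(Δ, t_pd, t_pp, t_pp′; ε)` (`λ ≠ 0`). [folklore] -/
theorem dWeightFace_smul {l : ℝ} (hl : l ≠ 0) (Δ tpd tpp c ε : ℝ) :
    dWeightFace (l * Δ) (l * tpd) (l * tpp) (l * c) (l * ε) = dWeightFace Δ tpd tpp c ε := by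
  unfold dWeightFace
  rw [yFace_smul hl, dWeight_smul hl]

/-- At fixed filling the antinodal weight of the scaled row equals that of the row (`λ > 0`). [folklore] -/
theorem dWeightFace_fermiEnergyOf_smul {l : ℝ} (hl : 0 < l) (Δ a b c ν : ℝ) :
    dWeightFace (l * Δ) (l * a) (l * b) (l * c) (fermiEnergyOf (l * Δ) (l * a) (l * b) (l * c) ν) =
      dWeightFace Δ a b c (fermiEnergyOf Δ a b c ν) := by
  rw [fermiEnergyOf_smul hl, dWeightFace_smul hl.ne']

/-- **The fixed-filling antinodal weight depends on the three ratios only**: `W(Δ, a, b, c) = W(Δ/a, 1, b/a, c/a)` (`a = t_pd > 0`). [folklore] -/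
theorem dWeightFace_fermiEnergyOf_eq_ratios {a : ℝ} (ha : 0 < a) (Δ b c ν : ℝ) :
    dWeightFace Δ a b c (fermiEnergyOf Δ a b c ν) =
      dWeightFace (Δ / a) 1 (b / a) (c / a) (fermiEnergyOf (Δ / a) 1 (b / a) (c / a) ν) := by
  have h := dWeightFace_fermiEnergyOf_smul ha (Δ / a) 1 (b / a) (c / a) ν
  rw [mul_div_cancel₀ _ ha.ne', mul_one, mul_div_cancel₀ _ ha.ne', mul_div_cancel₀ _ ha.ne'] at h
  exact h

/-! ## §2 Hole-likeness of a filling from the van Hove filling -/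

/-- `faceG(ε) = ε² + (Δ + 4t_pp′)ε − 4t_pd²` — the saddle-point quadratic of `EmeryVanHoveDoping` (`vhEnergy_quad`). [folklore] -/
theorem faceG_eq_quad (Δ tpd c ε : ℝ) : faceG Δ tpd c ε = ε ^ 2 + (Δ + 4 * c) * ε - 4 * tpd ^ 2 := by
  unfold faceG; ring

/-- `ε_VH ≤ ε` (with `Δ + 4t_pp′ ≥ 0`) ⇒ `faceG(ε) ≥ 0`: an energy at or above the saddle level has its contour reaching the zone face. [folklore] -/
theorem faceG_nonneg_of_vhEnergy_le {Δ tpd c ε : ℝ} (hD : 0 ≤ Δ + 4 * c) (hv : vhEnergy Δ tpd c ≤ ε) : 0 ≤ faceG Δ tpd c ε := by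
  have hq := vhEnergy_quad Δ tpd c
  have h0 := vhEnergy_nonneg Δ tpd c
  rw [faceG_eq_quad]
  have : 0 ≤ (ε - vhEnergy Δ tpd c) * (ε + vhEnergy Δ tpd c + (Δ + 4 * c)) := mul_nonneg (by linarith) (by linarith)
  nlinarith

/-- **A filling at or below the van Hove filling has its Fermi energy at or above the saddle level**: `abFilling(ε_VH) ≤ ν < 1` ⇒ `ε_VH ≤ ε_F(ν)`
(`Δ > 0`, `t_pd ≠ 0`, `0 ≤ t_pp′`, `0 ≤ t_pp`). [folklore] -/
theorem vhEnergy_le_fermiEnergyOf {Δ a b c ν : ℝ} (hΔ : 0 < Δ) (ha : a ≠ 0) (hc : 0 ≤ c) (hb : 0 ≤ b) (hν0 : 0 < ν) (hν1 : ν < 1)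
    (hν : abFilling Δ a b c (vhEnergy Δ a c) ≤ ν) : vhEnergy Δ a c ≤ fermiEnergyOf Δ a b c ν := by
  by_contra hlt
  push Not at hlt
  have hF := abFilling_fermiEnergyOf' hΔ ha hc hb hν0 hν1
  have hmono := abFilling_mono Δ a b c hlt.le
  have heq : abFilling Δ a b c (vhEnergy Δ a c) = ν := le_antisymm hν (by rw [← hF]; exact hmono)
  have := fermiEnergyOf_eq_of_abFilling_eq hΔ.le hc hb hν0 hν1 heq
  linarith

/-- **HOLE-LIKENESS FROM THE VAN HOVE DOPING**: `1 − 2ν ≤ x_VH(θ)` (the hole doping `x = 1 − 2ν` does not exceed the σ van Hove doping) ⇒ the Fermi surface of filling `ν`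
reaches the zone face: `0 ≤ faceG(θ; ε_F(θ; ν))`. [folklore] -/
theorem faceG_fermiEnergyOf_nonneg_of_xVH {Δ a b c ν : ℝ} (hΔ : 0 < Δ) (ha : a ≠ 0) (hc : 0 ≤ c) (hb : 0 ≤ b) (hν0 : 0 < ν) (hν1 : ν < 1)
    (hx : 1 - 2 * ν ≤ xVH Δ a b c) : 0 ≤ faceG Δ a c (fermiEnergyOf Δ a b c ν) := by
  have hν : abFilling Δ a b c (vhEnergy Δ a c) ≤ ν := by unfold xVH at hx; linarith
  exact faceG_nonneg_of_vhEnergy_le (by linarith) (vhEnergy_le_fermiEnergyOf hΔ ha hc hb hν0 hν1 hν)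

/-! ## §3 The fixed-filling one-coordinate steps -/

section Steps

/-- Attained fillings (for the Fermi-energy levers). [folklore] -/
theorem exists_abFilling_eq {Δ a b c ν : ℝ} (hΔ : 0 < Δ) (ha : a ≠ 0) (hc : 0 ≤ c) (hb : 0 ≤ b) (hν0 : 0 < ν) (hν1 : ν < 1) :
    ∃ ε : ℝ, abFilling Δ a b c ε = ν := by
  obtain ⟨ε, -, h⟩ := exists_fermiEnergy_of_mem_Ioo hΔ ha hc hb hν0 hν1
  exact ⟨ε, h⟩

/-- **Δ-STEP AT FIXED FILLING**: `Δ ≤ Δ′` ⇒ `W(Δ) ≤ W(Δ′)`, given hole-likeness of both rows at `ν`, the antinodal charge-transfer regime and the `t_pp′` margin at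
`(Δ; ε_F(Δ))`, and the upper face edge of row `Δ′` at the energy `ε_F(Δ)`. [folklore] -/
theorem dWeightFace_fermi_mono_Delta {Δ Δ' a b c ν : ℝ} (hΔ : 0 < Δ) (hΔΔ : Δ ≤ Δ') (ha : 0 < a) (hc : 0 ≤ c) (hcb : c ≤ b) (hν0 : 0 < ν) (hν1 : ν < 1)
    (hG : 0 ≤ faceG Δ a c (fermiEnergyOf Δ a b c ν)) (hG' : 0 ≤ faceG Δ' a c (fermiEnergyOf Δ' a b c ν))
    (hR : 4 * (b + c) ≤ Δ + fermiEnergyOf Δ a b c ν) (hm : c * fermiEnergyOf Δ a b c ν < a ^ 2)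
    (hU : cA Δ' (fermiEnergyOf Δ a b c ν) ≤ 8 * fsD Δ' a c (fermiEnergyOf Δ a b c ν) + 16 * fsN a b c (fermiEnergyOf Δ a b c ν)) :
    dWeightFace Δ a b c (fermiEnergyOf Δ a b c ν) ≤ dWeightFace Δ' a b c (fermiEnergyOf Δ' a b c ν) := by
  have hb : 0 ≤ b := hc.trans hcb
  have hΔ' : 0 < Δ' := lt_of_lt_of_le hΔ hΔΔ
  obtain ⟨δ, rfl⟩ : ∃ δ, Δ' = Δ + δ := ⟨Δ' - Δ, by ring⟩
  have hδ : 0 ≤ δ := by linarith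
  have hε : 0 < fermiEnergyOf Δ a b c ν := fermiEnergyOf_pos hΔ ha.ne' hc hb hν0 hν1
  have hε' : 0 < fermiEnergyOf (Δ + δ) a b c ν := fermiEnergyOf_pos hΔ' ha.ne' hc hb hν0 hν1
  have hle : fermiEnergyOf (Δ + δ) a b c ν ≤ fermiEnergyOf Δ a b c ν :=
    fermiEnergyOf_shift_le hΔ ha.ne' hc hb hδ hν0 hν1 (exists_abFilling_eq hΔ ha.ne' hc hb hν0 hν1) (exists_abFilling_eq hΔ' ha.ne' hc hb hν0 hν1)
  calc dWeightFace Δ a b c (fermiEnergyOf Δ a b c ν) ≤ dWeightFace (Δ + δ) a b c (fermiEnergyOf Δ a b c ν) :=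
        dWeightFace_mono_Delta hΔ (by linarith) hc hcb hε hm hG hR
    _ ≤ dWeightFace (Δ + δ) a b c (fermiEnergyOf (Δ + δ) a b c ν) :=
        dWeightFace_antitone hΔ' hc hcb ha.ne' hε' hle hm hG' hU

/-- **t_pp-STEP AT FIXED FILLING**: `b ≤ b′` ⇒ `W(b′) ≤ W(b)`, given hole-likeness of row `b` at `ν` (the form `faceG` does not see `t_pp`), the `t_pp′` margin at `ε_F(b′)`
and the upper face edge of row `b′` at its own Fermi energy. [folklore] -/
theorem dWeightFace_fermi_anti_tpp {Δ a b b' c ν : ℝ} (hΔ : 0 < Δ) (ha : 0 < a) (hc : 0 ≤ c) (hcb : c ≤ b) (hbb : b ≤ b') (hν0 : 0 < ν) (hν1 : ν < 1)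
    (hG : 0 ≤ faceG Δ a c (fermiEnergyOf Δ a b c ν)) (hm : c * fermiEnergyOf Δ a b' c ν < a ^ 2)
    (hU : cA Δ (fermiEnergyOf Δ a b' c ν) ≤ 8 * fsD Δ a c (fermiEnergyOf Δ a b' c ν) + 16 * fsN a b' c (fermiEnergyOf Δ a b' c ν)) :
    dWeightFace Δ a b' c (fermiEnergyOf Δ a b' c ν) ≤ dWeightFace Δ a b c (fermiEnergyOf Δ a b c ν) := by
  have hb : 0 ≤ b := hc.trans hcb
  have hb' : 0 ≤ b' := hb.trans hbb
  have hε : 0 < fermiEnergyOf Δ a b c ν := fermiEnergyOf_pos hΔ ha.ne' hc hb hν0 hν1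
  have hle : fermiEnergyOf Δ a b c ν ≤ fermiEnergyOf Δ a b' c ν :=
    fermiEnergyOf_mono_tpp hΔ.le hc hb hbb hν0 hν1 (exists_abFilling_eq hΔ ha.ne' hc hb hν0 hν1) (exists_abFilling_eq hΔ ha.ne' hc hb' hν0 hν1)
  have hm0 : c * fermiEnergyOf Δ a b c ν < a ^ 2 := lt_of_le_of_lt (mul_le_mul_of_nonneg_left hle hc) hm
  calc dWeightFace Δ a b' c (fermiEnergyOf Δ a b' c ν) ≤ dWeightFace Δ a b' c (fermiEnergyOf Δ a b c ν) :=
        dWeightFace_antitone hΔ hc (hcb.trans hbb) ha.ne' hε hle hm hG hU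
    _ ≤ dWeightFace Δ a b c (fermiEnergyOf Δ a b c ν) :=
        dWeightFace_anti_tpp hΔ hc hcb hbb hε hm0 hG

/-- **t_pp′-STEP AT FIXED FILLING**: `c ≤ c′` ⇒ `W(c) ≤ W(c′)`, given hole-likeness of both rows at `ν`, the antinodal charge-transfer regime (at `c′`) and the margin at
`ε_F(c)`, and the upper face edge of row `c′` at the energy `ε_F(c)`. [folklore] -/
theorem dWeightFace_fermi_mono_tppP {Δ a b c c' ν : ℝ} (hΔ : 0 < Δ) (ha : 0 < a) (hc : 0 ≤ c) (hcc : c ≤ c') (hcb : c' ≤ b) (hν0 : 0 < ν) (hν1 : ν < 1)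
    (hG : 0 ≤ faceG Δ a c (fermiEnergyOf Δ a b c ν)) (hG' : 0 ≤ faceG Δ a c' (fermiEnergyOf Δ a b c' ν))
    (hR : 4 * (b + c') ≤ Δ + fermiEnergyOf Δ a b c ν) (hm : c' * fermiEnergyOf Δ a b c ν < a ^ 2)
    (hU : cA Δ (fermiEnergyOf Δ a b c ν) ≤ 8 * fsD Δ a c' (fermiEnergyOf Δ a b c ν) + 16 * fsN a b c' (fermiEnergyOf Δ a b c ν)) :
    dWeightFace Δ a b c (fermiEnergyOf Δ a b c ν) ≤ dWeightFace Δ a b c' (fermiEnergyOf Δ a b c' ν) := by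
  have hb : 0 ≤ b := hc.trans (hcc.trans hcb)
  have hc' : 0 ≤ c' := hc.trans hcc
  obtain ⟨γ, rfl⟩ : ∃ γ, c' = c + γ := ⟨c' - c, by ring⟩
  have hγ : 0 ≤ γ := by linarith
  have hε' : 0 < fermiEnergyOf Δ a b (c + γ) ν := fermiEnergyOf_pos hΔ ha.ne' hc' hb hν0 hν1
  have hle : fermiEnergyOf Δ a b (c + γ) ν ≤ fermiEnergyOf Δ a b c ν :=
    fermiEnergyOf_anti_tppP hΔ ha.ne' hc hb hγ hν0 hν1 (exists_abFilling_eq hΔ ha.ne' hc hb hν0 hν1) (exists_abFilling_eq hΔ ha.ne' hc' hb hν0 hν1)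
  have hε : 0 < fermiEnergyOf Δ a b c ν := lt_of_lt_of_le hε' hle
  calc dWeightFace Δ a b c (fermiEnergyOf Δ a b c ν) ≤ dWeightFace Δ a b (c + γ) (fermiEnergyOf Δ a b c ν) :=
        dWeightFace_mono_tppP hΔ hc (by linarith) hcb hε hm hG hR
    _ ≤ dWeightFace Δ a b (c + γ) (fermiEnergyOf Δ a b (c + γ) ν) :=
        dWeightFace_antitone hΔ hc' hcb ha.ne' hε' hle hm hG' hU

end Steps

end Summit.Ventures.CertifiedManyBodySolver.Downfold.Emery
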